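import Literature.NumberTheory.QuadraticFields.KroneckerCharacterFourProofs
import Mathlib.NumberTheory.Padics.PadicNumbers
import HarnessLib

/-!
# Crux `PrintCFram.BottomClassIndexLawFiveLe` (stmt-BirchSwinnertonDyer-20372), line `eisenstein-resource-bdp-line`:
# the KRIZ–LI BINDERS CLASS-LEVEL, part K-even — the `ℚ_p`-valued Kronecker character of an EVEN fundamental discriminant
# `4m` (`m ≡ 2, 3 (mod 4)` squarefree), `a ↦ [a odd]·J(m | a)` mod `4|m|`, EXISTS, is QUADRATIC and is PRIMITIVE
# (cell `bsd-print-cfram`, width seat `bsd-line-cfram-p1-w3` g2; THEOREMS ONLY, `--supports` 20372; BSD is not proved by any of this)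

HONEST FRAMING. Nothing here is a statement about BSD or about any curve. Companion of `…KrizLiBindersKroneckerOdd` (read its
header): the character data `ψ = χ_D·ω^k` of Kriz–Li Thm. 1.20 on the crux's class needs the Kronecker character `χ_D` of the
member's twisting discriminant with values in `ℚ_p`; here the EVEN discriminants `D = 4m`. Stated by EXISTENCE theorems
characterised by VALUES (no definition), for every prime `p`:

* `exists_kroneckerFourPadic` — for `m ≠ 0` a character `χ` mod `k = 4|m|` with `χ(a) = [a odd]·J(m | a)` for every `a : ℕ`;
* `isQuadratic_of_forall_eq_kroneckerFour`, `apply_natCast_sq_eq_one_…`, `apply_natCast_eq_zero_iff_…`;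
* **`isPrimitive_of_forall_eq_kroneckerFour`** (`m ≡ 2, 3 (mod 4)` squarefree ⟹ conductor `4|m|`), and the primed
  variant taking the `[a odd]·J(m | a)` value form.

This is exactly the shape in which the tree's twisting formula `LFunction_quadraticTwist_apply_of_four_dvd_discr` delivers
`a_ℓ(E^{(4m)}) = [ℓ odd]·J(m | ℓ)·a_ℓ(E)` — consumed by part W of this series. Proofs: adapted (`ℚ_7 → ℚ_p`, verbatim otherwise)
from `Summits/BirchSwinnertonDyer/Rank1Residual/X12/O11/RouteUKroneckerEven.lean` (cell `bsd-cm`, itself the port of the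
ℂ-valued `Literature/NumberTheory/QuadraticFields/KroneckerCharacterFourProofs.lean`, whose Jacobi-symbol value lemmas are
reused by name). beyond-print theorem: NO.

References: [MontgomeryVaughan2007] Thm. 9.13; [Cox2013] §1.C Lemma 1.14; [KrizLi2019] §2 (p. 12, `ε_K` and the conventions
on primitive characters).
-/

noncomputable section

-- summit-side namespace `Summit.BirchSwinnertonDyer.BirchSwinnertonDyer.…` (single-conjunct summit, D-0017 layout)
set_option linter.dupNamespace false

open scoped Classical NumberTheorySymbols
open Literature.NumberTheory.QuadraticFields

namespace Summit.BirchSwinnertonDyer.BirchSwinnertonDyer.Theorems.PrintCFram.KrizLiBinders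

variable {p : ℕ} [Fact p.Prime]

/-! ## Even discriminants `4m`: `a ↦ [a odd]·J(m | a)` as a `ℚ_p`-valued Dirichlet character mod `4|m|` -/

/-- **The Kronecker symbol `a ↦ (m / a)` as a `ℚ_p`-valued Dirichlet character mod `4|m|`** (`m ≠ 0`): there is a
Dirichlet character `χ` modulo `k = 4|m|` with `χ(a) = J(m | a)` for odd `a` and `χ(a) = 0` for even `a`, i.e.
`χ(a) = [a odd]·J(m | a)` for every `a : ℕ`. Well defined because `J(m | a)` depends only on `a mod 4|m|` for odd `a`
(Mathlib `jacobiSym.mod_right`). The level is any `k` with a proof `k = 4|m|`.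
-- adapted from Summits/BirchSwinnertonDyer/Rank1Residual/X12/O11/RouteUKroneckerEven.lean (`exists_kroneckerFour`, ℚ_7-valued),
-- itself adapted from Literature/NumberTheory/QuadraticFields/KroneckerCharacterFourProofs.lean (ℂ-valued)
[cite: Cox2013, §1.C Lemma 1.14] -/
theorem exists_kroneckerFourPadic (m : ℤ) (hm0 : m ≠ 0) {k : ℕ} (hk : k = 4 * m.natAbs) :
    ∃ χ : DirichletCharacter ℚ_[p] k,
      ∀ a : ℕ, χ (a : ZMod k) = ((if Even a then (0 : ℤ) else J(m | a) : ℤ) : ℚ_[p]) := by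
  subst hk
  set q : ℕ := 4 * m.natAbs with hq
  have hq0 : q ≠ 0 := mul_ne_zero (by norm_num) (Int.natAbs_ne_zero.mpr hm0)
  haveI : NeZero q := ⟨hq0⟩
  have hq2 : 2 ∣ q := ⟨2 * m.natAbs, by rw [hq]; ring⟩
  -- parity of `x % q` is that of `x`
  have hpar : ∀ x : ℕ, Even (x % q) ↔ Even x := fun x ↦ by
    have h2x : Even (q * (x / q)) := (even_iff_two_dvd.mpr hq2).mul_right _
    refine ⟨fun h ↦ ?_, fun h ↦ ?_⟩
    · rw [← Nat.mod_add_div x q]; exact h.add h2x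
    · have h' : Even (x % q + q * (x / q)) := by rwa [Nat.mod_add_div]
      exact (Nat.even_add.mp h').mpr h2x
  -- the values
  set f : ZMod q → ℚ_[p] := fun a ↦ if Even a.val then 0 else (J(m | a.val) : ℚ_[p]) with hf
  have hf_odd : ∀ a : ℕ, Odd a → f a = (J(m | a) : ℚ_[p]) := fun a ha ↦ by
    have hodd : ¬ Even ((a : ZMod q).val) := by
      rw [ZMod.val_natCast, hpar]; exact Nat.not_even_iff_odd.mpr ha
    simp only [hf, if_neg hodd]
    rw [ZMod.val_natCast, ← jacobiSym.mod_right m ha]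
  have hf_even : ∀ a : ZMod q, Even a.val → f a = 0 := fun a ha ↦ by simp only [hf, if_pos ha]
  refine ⟨{ toFun := f, map_one' := ?_, map_mul' := ?_, map_nonunit' := ?_ }, ?_⟩
  · have h1 := hf_odd 1 odd_one
    rw [jacobiSym.one_right, Int.cast_one] at h1
    simpa using h1
  · intro a b
    have hab : (a * b).val = (a.val * b.val) % q := ZMod.val_mul a b
    by_cases ha : Even a.val
    · have h : Even (a * b).val := by rw [hab, hpar, Nat.even_mul]; exact Or.inl ha
      rw [hf_even _ h, hf_even _ ha, zero_mul]
    · by_cases hb : Even b.val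
      · have h : Even (a * b).val := by rw [hab, hpar, Nat.even_mul]; exact Or.inr hb
        rw [hf_even _ h, hf_even _ hb, mul_zero]
      · have ha' := Nat.not_even_iff_odd.mp ha
        have hb' := Nat.not_even_iff_odd.mp hb
        have hab' : ¬ Even (a * b).val := by
          rw [hab, hpar, Nat.even_mul, not_or]
          exact ⟨ha, hb⟩
        calc f (a * b) = (J(m | (a * b).val) : ℚ_[p]) := by simp only [hf, if_neg hab']
          _ = (J(m | a.val * b.val) : ℚ_[p]) := by rw [hab, ← jacobiSym.mod_right m (ha'.mul hb')]
          _ = (J(m | a.val) : ℚ_[p]) * (J(m | b.val) : ℚ_[p]) := by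
            rw [jacobiSym.mul_right' m ha'.pos.ne' hb'.pos.ne', Int.cast_mul]
          _ = f a * f b := by simp only [hf, if_neg ha, if_neg hb]
  · intro a ha
    by_cases hev : Even a.val
    · exact hf_even a hev
    · have hodd := Nat.not_even_iff_odd.mp hev
      rw [← ZMod.natCast_zmod_val a, hf_odd _ hodd, Int.cast_eq_zero]
      have hval : ¬ a.val.Coprime q := fun h ↦ ha (by
        rw [← ZMod.natCast_zmod_val a]
        exact (ZMod.isUnit_iff_coprime a.val q).mpr h)
      haveI : NeZero a.val := ⟨hodd.pos.ne'⟩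
      rw [jacobiSym.eq_zero_iff_not_coprime, Int.gcd_comm, Int.gcd_eq_natAbs, Int.natAbs_natCast]
      intro hcop
      apply hval
      change a.val.Coprime (4 * m.natAbs)
      refine Nat.Coprime.mul_right ?_ hcop
      exact Nat.Coprime.pow_right 2 (Nat.coprime_two_right.mpr hodd)
  · intro a
    by_cases ha : Even a
    · rw [if_pos ha, Int.cast_zero]
      have hev : Even ((a : ZMod q).val) := by rw [ZMod.val_natCast, hpar]; exact ha
      exact hf_even _ hev
    · rw [if_neg ha]
      exact hf_odd a (Nat.not_even_iff_odd.mp ha)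

section EvenValues

variable {m : ℤ} {k : ℕ} {χ : DirichletCharacter ℚ_[p] k}

/-- From the `[a odd]·J(m | a)` value form to the «values at odd `a`» form. [folklore] -/
theorem apply_eq_jacobiSym_of_odd
    (hχ : ∀ a : ℕ, χ (a : ZMod k) = ((if Even a then (0 : ℤ) else J(m | a) : ℤ) : ℚ_[p]))
    (a : ℕ) (ha : Odd a) : χ (a : ZMod k) = (J(m | a) : ℚ_[p]) := by
  rw [hχ a, if_neg (Nat.not_even_iff_odd.mpr ha)]

/-- A character with `χ(a) = [a odd]·J(m | a)` vanishes at even `a`. [folklore] -/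
theorem apply_eq_zero_of_even'
    (hχ : ∀ a : ℕ, χ (a : ZMod k) = ((if Even a then (0 : ℤ) else J(m | a) : ℤ) : ℚ_[p]))
    (a : ℕ) (ha : Even a) : χ (a : ZMod k) = 0 := by
  rw [hχ a, if_pos ha, Int.cast_zero]

/-- A character with `χ(a) = [a odd]·J(m | a)` is quadratic (values in `{0, 1, −1}`). [folklore] -/
theorem isQuadratic_of_forall_eq_kroneckerFour [NeZero k]
    (hχ : ∀ a : ℕ, χ (a : ZMod k) = ((if Even a then (0 : ℤ) else J(m | a) : ℤ) : ℚ_[p])) :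
    χ.IsQuadratic := by
  intro a
  rw [← ZMod.natCast_zmod_val a, hχ a.val]
  split_ifs with h
  · exact Or.inl (by rw [Int.cast_zero])
  · rcases jacobiSym.trichotomy m a.val with h | h | h <;> simp [h]

/-- `χ(a)² = 1` at every `a` coprime to `k = 4|m|`. [folklore] -/
theorem apply_natCast_sq_eq_one_of_forall_eq_kroneckerFour (hk : k = 4 * m.natAbs)
    (hχ : ∀ a : ℕ, χ (a : ZMod k) = ((if Even a then (0 : ℤ) else J(m | a) : ℤ) : ℚ_[p]))
    {a : ℕ} (ha : a.Coprime k) : χ (a : ZMod k) ^ 2 = 1 := by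
  have h2 : a.Coprime 2 := ha.coprime_dvd_right ⟨2 * m.natAbs, by rw [hk]; ring⟩
  have hodd : Odd a := Nat.coprime_two_right.mp h2
  have ham : a.Coprime m.natAbs := ha.coprime_dvd_right ⟨4, by rw [hk]; ring⟩
  rw [apply_eq_jacobiSym_of_odd hχ a hodd]
  have hg : m.gcd (a : ℤ) = 1 := by
    rw [Int.gcd_comm, Int.gcd_eq_natAbs, Int.natAbs_natCast]; exact ham
  rcases jacobiSym.eq_one_or_neg_one hg with h | h <;> rw [h] <;> norm_num

/-- `χ(a) = 0 ↔ (a, 4|m|) ≠ 1`. [folklore] -/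
theorem apply_natCast_eq_zero_iff_of_forall_eq_kroneckerFour [NeZero k] (hk : k = 4 * m.natAbs)
    (hχ : ∀ a : ℕ, χ (a : ZMod k) = ((if Even a then (0 : ℤ) else J(m | a) : ℤ) : ℚ_[p]))
    (a : ℕ) : χ (a : ZMod k) = 0 ↔ ¬ a.Coprime k := by
  constructor
  · intro h0 hcop
    have h1 := apply_natCast_sq_eq_one_of_forall_eq_kroneckerFour hk hχ hcop
    rw [h0] at h1; norm_num at h1
  · intro hn
    exact MulChar.map_nonunit χ (by rwa [ZMod.isUnit_iff_coprime])

/-- **The `ℚ_p`-valued character mod `4|m|` with values `J(m | a)` at odd `a` is PRIMITIVE** for `m ≡ 2, 3 (mod 4)`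
squarefree (conductor `4|m| = |4m|`, the Kronecker character of the even fundamental discriminant `4m`): a factorisation
through a proper divisor `c` of the level is refuted by a unit `u ≡ 1 (mod c)` with `χ(u) = −1` (`u = 1 + 2|m|` when
`4|m|/c` is even — this uses `m ≡ 2, 3 (mod 4)`; a non-residue modulo an odd prime `ℓ ∣ 4|m|/c` otherwise — this uses `ℓ² ∤ m`).
-- adapted from Summits/BirchSwinnertonDyer/Rank1Residual/X12/O11/RouteUKroneckerEven.lean (`isPrimitive_kroneckerFour`, ℚ_7-valued)
[cite: MontgomeryVaughan2007, Theorem 9.13] [cite: Cox2013, §1.C Lemma 1.14] -/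
theorem isPrimitive_of_forall_eq_kroneckerFour (hk : k = 4 * m.natAbs) (hm4 : m % 4 = 2 ∨ m % 4 = 3)
    (hsq : Squarefree m) (hχ : ∀ a : ℕ, Odd a → χ (a : ZMod k) = (J(m | a) : ℚ_[p])) : χ.IsPrimitive := by
  subst hk
  have hm0 : m ≠ 0 := hsq.ne_zero
  have hn0 : 0 < m.natAbs := Int.natAbs_pos.mpr hm0
  have hsqn : Squarefree m.natAbs := Int.squarefree_natAbs.mpr hsq
  haveI : NeZero (4 * m.natAbs) := ⟨by omega⟩
  rw [DirichletCharacter.isPrimitive_def]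
  have hcdvd : χ.conductor ∣ 4 * m.natAbs := DirichletCharacter.conductor_dvd_level χ
  have hft : χ.FactorsThrough χ.conductor := DirichletCharacter.factorsThrough_conductor χ
  by_contra hne
  -- it suffices to find a unit `u ≡ 1 (mod c)` with `χ u = -1`
  suffices key : ∃ u : ℕ, u.Coprime (4 * m.natAbs) ∧ (u : ZMod χ.conductor) = 1 ∧ χ u = -1 by
    obtain ⟨u, hu, hu1, hχu⟩ := key
    have hker := (DirichletCharacter.factorsThrough_iff_ker_unitsMap hcdvd).mp hft
    have hx : ZMod.unitOfCoprime u hu ∈ (ZMod.unitsMap hcdvd).ker := by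
      rw [MonoidHom.mem_ker, ZMod.unitsMap_def, Units.ext_iff, Units.coe_map, MonoidHom.coe_coe,
        ZMod.castHom_apply, Units.val_one, ZMod.coe_unitOfCoprime, ZMod.cast_natCast hcdvd]
      exact hu1
    have h1 := hker hx
    rw [MonoidHom.mem_ker, Units.ext_iff, MulChar.coe_toUnitHom, Units.val_one,
      ZMod.coe_unitOfCoprime, hχu] at h1
    norm_num at h1
  -- a prime `ℓ` dividing `4|m| / c`
  obtain ⟨k, hk⟩ := hcdvd
  have hk1 : k ≠ 1 := fun h ↦ hne (by rw [h, mul_one] at hk; exact hk.symm)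
  obtain ⟨ℓ, hℓ, hℓk⟩ := Nat.exists_prime_and_dvd hk1
  -- the sign of `m` does not matter at `u ≡ 1 (mod 4)`
  have hsign : ∀ {u : ℕ}, Odd u → u % 4 = 1 → J(m | u) = J((m.natAbs : ℤ) | u) := fun hu hu4 ↦ by
    rw [jacobiSym_eq_sign_mul_natAbs m hu]
    split_ifs
    · rw [ZMod.χ₄_nat_one_mod_four hu4, one_mul]
    · rw [one_mul]
  have hcop4 : ∀ {u : ℕ}, Odd u → u.Coprime 4 := fun hu ↦ by
    simpa using Nat.Coprime.pow_right 2 (Nat.coprime_two_right.mpr hu)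
  by_cases hℓ2 : ℓ = 2
  · /- `ℓ = 2`: `c ∣ 2|m|`; take `u = 1 + 2|m|` -/
    subst hℓ2
    obtain ⟨k', hk'⟩ := hℓk
    have hc2n : χ.conductor ∣ 2 * m.natAbs := ⟨k', by
      have h4 : 4 * m.natAbs = 2 * (χ.conductor * k') :=
        calc 4 * m.natAbs = χ.conductor * k := hk
          _ = 2 * (χ.conductor * k') := by rw [hk']; ring
      omega⟩
    have huodd : Odd (1 + 2 * m.natAbs) := ⟨m.natAbs, by ring⟩
    refine ⟨1 + 2 * m.natAbs, ?_, ?_, ?_⟩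
    · refine Nat.Coprime.mul_right (hcop4 huodd) ?_
      have h := (Nat.coprime_add_mul_left_left 1 m.natAbs 2).mpr (Nat.coprime_one_left _)
      rwa [mul_comm] at h
    · rw [Nat.cast_add, Nat.cast_one, (ZMod.natCast_eq_zero_iff (2 * m.natAbs) χ.conductor).mpr hc2n,
        add_zero]
    · rw [hχ _ huodd]
      suffices h : J(m | 1 + 2 * m.natAbs) = -1 by rw [h]; norm_num
      rcases hm4 with h4 | h4
      · -- `m ≡ 2 (mod 4)`: `|m| = 2n₀`, `n₀` odd, `u = 4n₀ + 1 ≡ 5 (mod 8)`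
        obtain ⟨n₀, hn₀⟩ : 2 ∣ m.natAbs := by omega
        have hn₀2 : n₀ % 2 = 1 := by omega
        have hn₀odd : Odd n₀ := Nat.odd_iff.mpr hn₀2
        have hu4 : (1 + 2 * m.natAbs) % 4 = 1 := by omega
        rw [hsign huodd hu4, show (m.natAbs : ℤ) = 2 * (n₀ : ℤ) by rw [hn₀]; push_cast; ring,
          jacobiSym.mul_left, jacobiSym.at_two huodd,
          (χ₈_nat_of_mod_eight (b := 1 + 2 * m.natAbs)).2 (by omega),
          jacobiSym_eq_one_of_mod_four_eq_one_of_emod_eq_one hn₀odd hu4 ?_]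
        · norm_num
        · rw [hn₀]
          push_cast
          rw [show (1 : ℤ) + 2 * (2 * (n₀ : ℤ)) = 1 + (n₀ : ℤ) * 4 by ring, Int.add_mul_emod_self_left]
      · -- `m ≡ 3 (mod 4)`: `|m|` odd, `u = 2|m| + 1 ≡ 3 (mod 4)`
        have hnodd : Odd m.natAbs := Nat.odd_iff.mpr (by omega)
        have hu4 : (1 + 2 * m.natAbs) % 4 = 3 := by omega
        have hJn : J((m.natAbs : ℤ) | 1 + 2 * m.natAbs) = ZMod.χ₄ m.natAbs :=
          jacobiSym_eq_χ₄_of_mod_four_eq_three_of_emod_eq_one hnodd hu4 (by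
            push_cast
            rw [show (1 : ℤ) + 2 * |m| = 1 + |m| * 2 by ring, Int.add_mul_emod_self_left])
        rw [jacobiSym_eq_sign_mul_natAbs m huodd, hJn]
        split_ifs with hneg
        · rw [ZMod.χ₄_nat_three_mod_four hu4, ZMod.χ₄_nat_one_mod_four (by omega)]
          norm_num
        · rw [one_mul, ZMod.χ₄_nat_three_mod_four (by omega)]
  · /- `ℓ` odd: `ℓ ∣ |m|`, `c ∣ 4|m|/ℓ = 4n'`; take `u ≡ 1 (mod 4n')`, `u` a non-residue mod `ℓ` -/
    haveI := Fact.mk hℓ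
    have hℓodd : Odd ℓ := hℓ.odd_of_ne_two hℓ2
    have hℓq : ℓ ∣ 4 * m.natAbs := hk ▸ hℓk.mul_left χ.conductor
    have hℓn : ℓ ∣ m.natAbs := (hcop4 hℓodd).dvd_of_dvd_mul_left hℓq
    obtain ⟨n', hn'⟩ := hℓn
    have hn'0 : 0 < n' := Nat.pos_of_ne_zero fun h ↦ by rw [h, mul_zero] at hn'; omega
    have hℓn' : ¬ ℓ ∣ n' := fun h ↦ by
      have : ℓ * ℓ ∣ m.natAbs := hn' ▸ mul_dvd_mul_left ℓ h
      exact hℓ.one_lt.ne' (Nat.isUnit_iff.mp (hsqn ℓ this))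
    -- `c ∣ 4 n'`
    have hc4n' : χ.conductor ∣ 4 * n' := by
      obtain ⟨k', hk'⟩ := hℓk
      refine ⟨k', Nat.eq_of_mul_eq_mul_left hℓ.pos ?_⟩
      calc ℓ * (4 * n') = 4 * m.natAbs := by rw [hn']; ring
        _ = χ.conductor * k := hk
        _ = ℓ * (χ.conductor * k') := by rw [hk']; ring
    -- a non-residue `a` mod `ℓ` and `u ≡ a (mod ℓ)`, `u ≡ 1 (mod 4n')`
    have hcop : ℓ.Coprime (4 * n') :=
      Nat.Coprime.mul_right (hcop4 hℓodd) ((Nat.Prime.coprime_iff_not_dvd hℓ).mpr hℓn')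
    have hchar : ringChar (ZMod ℓ) ≠ 2 := by rwa [ZMod.ringChar_zmod_n]
    obtain ⟨a, ha⟩ := quadraticChar_exists_neg_one hchar
    have ha0 : a ≠ 0 := by
      rintro rfl
      rw [MulChar.map_zero] at ha; norm_num at ha
    obtain ⟨u, hu1, hu2⟩ := Nat.chineseRemainder hcop a.val 1
    have huℓ : u % ℓ = a.val := by
      rw [show u % ℓ = a.val % ℓ from hu1, Nat.mod_eq_of_lt (ZMod.val_lt a)]
    have hu4n' : u % (4 * n') = 1 := by
      rw [show u % (4 * n') = 1 % (4 * n') from hu2, Nat.mod_eq_of_lt (by omega)]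
    have hu4 : u % 4 = 1 := by
      have := Nat.mod_mod_of_dvd u (dvd_mul_right 4 n')
      rw [hu4n'] at this
      omega
    have huodd : Odd u := Nat.odd_iff.mpr (by omega)
    refine ⟨u, ?_, ?_, ?_⟩
    · -- `u` is a unit mod `4|m| = ℓ · 4n'`
      have huℓ' : u.Coprime ℓ := by
        refine ((Nat.Prime.coprime_iff_not_dvd hℓ).mpr fun h ↦ ha0 ?_).symm
        rw [← ZMod.val_eq_zero, ← huℓ]
        exact Nat.mod_eq_zero_of_dvd h
      have hur : u.Coprime (4 * n') := by
        have h := Nat.ModEq.gcd_eq (hu2 : u ≡ 1 [MOD 4 * n'])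
        rwa [Nat.gcd_one_left] at h
      rw [show 4 * m.natAbs = ℓ * (4 * n') by rw [hn']; ring]
      exact Nat.Coprime.mul_right huℓ' hur
    · have h := (ZMod.natCast_eq_natCast_iff u 1 χ.conductor).mpr (Nat.ModEq.of_dvd hc4n' hu2)
      rwa [Nat.cast_one] at h
    · rw [hχ _ huodd, hsign huodd hu4, hn', Nat.cast_mul, jacobiSym.mul_left,
        jacobiSym.quadratic_reciprocity_one_mod_four' hℓodd hu4,
        jacobiSym_natCast_eq_one_of_mod_four_mul huodd hu4n', mul_one, ← jacobiSym_natCast_mod,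
        huℓ, ← jacobiSym.legendreSym.to_jacobiSym, legendreSym, Int.cast_natCast, ZMod.natCast_zmod_val,
        ha]
      norm_num

/-- The `[a odd]·J(m | a)` form implies the «values at odd `a`» hypothesis of `isPrimitive_of_forall_eq_kroneckerFour`;
packaged primitivity. [cite: MontgomeryVaughan2007, Theorem 9.13] -/
theorem isPrimitive_of_forall_eq_kroneckerFour' (hk : k = 4 * m.natAbs) (hm4 : m % 4 = 2 ∨ m % 4 = 3)
    (hsq : Squarefree m)
    (hχ : ∀ a : ℕ, χ (a : ZMod k) = ((if Even a then (0 : ℤ) else J(m | a) : ℤ) : ℚ_[p])) : χ.IsPrimitive :=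
  isPrimitive_of_forall_eq_kroneckerFour hk hm4 hsq (apply_eq_jacobiSym_of_odd hχ)

end EvenValues

end Summit.BirchSwinnertonDyer.BirchSwinnertonDyer.Theorems.PrintCFram.KrizLiBinders

end
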